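import Summits.NavierStokesRegularity.NavierStokesRegularity.Theses.AxisymmetricExtremality
import Summits.NavierStokesRegularity.NavierStokesRegularity.Theorems.AxisymmetricExtremalityPFoldToAxisymmetricCompactModuloSim
import Literature.Analysis.FluidPDE.RusinSverakCompactnessHolds
import Literature.Analysis.FluidPDE.RusinSverakMinimalData
import Literature.Analysis.FluidPDE.HomSobolevRepresentedL3

/-!
# Route AxisymmetricExtremality — crux `MinimalDatumPFold` (stmt-NavierStokesRegularity-15452), stub `stub_nearMinimalLimit`

Registered stub of the line `symmetric-gap` (`Cruxes/MinimalDatumPFold/Lines/symmetric_gap.lean`, lead c1, cycle 2).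
Target tree file: `Summits/NavierStokesRegularity/NavierStokesRegularity/Theorems/AxisymmetricExtremalityMinimalDatumPFoldNearMinimalLimit.lean`.

**Near-minimal blow-up sequences have minimal `L³`-limits modulo `Sim`.** For `ν > 0` with
`ρ := rusinSverakRhoMaxPure ν < ⊤`, a sequence of blow-up data `(U k, G k)` (`U k ∈ L³`, `G k`
represents `complexify ∘ U k`, weakly divergence free, no global Kato solution) with
`‖G k‖ₑ < ρ + (k+1)⁻¹` admits scales `lam j > 0`, centres `x₀ j`, a subsequence `φ` and a MINIMAL
blow-up datum `(u, g) ∈ M` (`IsMinimalBlowupDatum ν u g`) with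
`rescaleData (lam j) (U (φ j) (· - x₀ j)) → u` in `L³(ℝ³)`.

Proof (Rusin–Šverák 2011, proof of Cor. 4.3, p. 8, run for a near-minimal sequence; it is the
tree's proof of `rusin_sverak_minimal_blowup_of_weak_limit_blowup` followed by the strong ending of
`rusin_sverak_minimal_data_subseq_limit_of_weak_limit_blowup` / `stub_compactModuloSim`):

1. `ρ ≤ ‖G k‖ₑ` since `U k` blows up (`hasGlobalKatoSolution_of_lt_rusinSverakRhoMaxPure`), and
   `‖G k‖ ≤ ρ.toReal + 1/(k+1) ≤ ρ.toReal + 1` from the hypothesis.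
2. `rusin_sverak_weak_limit_blowup_holds` (the discharged PDE leaf) gives the modulation
   `lam k, x₀ k`; the modulated data are represented by classes `g' k` of the same norms
   (`exists_represents_rescaleData_norm_eq`).
3. A subsequence `g' (φ n)` converges weakly (`exists_strictMono_tendsto_inner`, `Ḣ^{1/2}` is
   separable: `homSobolev_half_secondCountableTopology`) to `glim`, which represents a blow-up
   datum `v₀` (the leaf); hence `ρ ≤ ‖glim‖ₑ`, while `‖glim‖ ≤ lim (ρ.toReal + 1/(φ n + 1)) = ρ.toReal`
   by weak lower semicontinuity (`norm_le_of_tendsto_inner_of_norm_le`): `(v₀, glim) ∈ M`.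
4. `‖g' (φ n)‖ → ρ.toReal = ‖glim‖` (squeeze), so Radon–Riesz with converging norms
   (`nearMinimalLimit_tendsto_of_tendsto_inner_of_tendsto_norm`,
   `‖x n - a‖² = ‖x n‖² - 2 Re ⟪x n, a⟫ + ‖a‖² → 0`) gives `g' (φ n) → glim` in `Ḣ^{1/2}`.
5. `‖v_j - v₀‖_{L³} ≤ C ‖g' (φ j) - glim‖ → 0` (`eLpNorm_three_sub_le_of_represents`,
   Bahouri–Chemin–Danchin 2011 Thm. 1.38 via `exists_const_eLpNorm_three_le_of_represents_complexify`).

References: W. Rusin, V. Šverák, J. Funct. Anal. 260 (2011) 879–891 = arXiv:0911.0500, Cor. 4.3 and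
its proof (p. 8) [RusinSverak2011]; H. Bahouri, J.-Y. Chemin, R. Danchin, *Fourier Analysis and
Nonlinear PDE* (2011), Thm. 1.38 [BahouriCheminDanchin2011].
-/

set_option linter.dupNamespace false

noncomputable section

open MeasureTheory Set Function Filter Topology
open scoped ENNReal NNReal InnerProductSpace

namespace Summit.NavierStokesRegularity.NavierStokesRegularity.Theorems

/-- **Radon–Riesz property of Hilbert spaces, with converging norms**: if `x n → a` weakly
(`⟪x n, w⟫ → ⟪a, w⟫` for all `w`) and `‖x n‖ → ‖a‖`, then `x n → a` in norm, since
`‖x n - a‖² = ‖x n‖² - 2 Re ⟪x n, a⟫ + ‖a‖² → ‖a‖² - 2‖a‖² + ‖a‖² = 0`. (The tree's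
`Literature.Analysis.FluidPDE.tendsto_of_tendsto_inner_of_norm_eq` is the constant-norm case.)
[folklore] -/
private theorem nearMinimalLimit_tendsto_of_tendsto_inner_of_tendsto_norm {H : Type*}
    [NormedAddCommGroup H] [InnerProductSpace ℂ H] {x : ℕ → H} {a : H}
    (hw : ∀ w : H, Tendsto (fun n => ⟪x n, w⟫_ℂ) atTop (𝓝 ⟪a, w⟫_ℂ))
    (hn : Tendsto (fun n => ‖x n‖) atTop (𝓝 ‖a‖)) : Tendsto x atTop (𝓝 a) := by
  have hre : Tendsto (fun n => RCLike.re ⟪x n, a⟫_ℂ) atTop (𝓝 (‖a‖ ^ 2)) := by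
    have h1 : Tendsto (fun n => RCLike.re ⟪x n, a⟫_ℂ) atTop (𝓝 (RCLike.re ⟪a, a⟫_ℂ)) :=
      (RCLike.continuous_re.tendsto _).comp (hw a)
    have h2 : RCLike.re ⟪a, a⟫_ℂ = ‖a‖ ^ 2 := by
      rw [inner_self_eq_norm_sq_to_K]; norm_cast
    rwa [h2] at h1
  have hsq : Tendsto (fun n => ‖x n - a‖ ^ 2) atTop (𝓝 0) := by
    have h2 : ∀ n, ‖x n - a‖ ^ 2 = ‖x n‖ ^ 2 - 2 * RCLike.re ⟪x n, a⟫_ℂ + ‖a‖ ^ 2 := fun n =>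
      @norm_sub_sq ℂ _ _ _ _ (x n) a
    simp_rw [h2]
    have h3 : Tendsto (fun n => ‖x n‖ ^ 2 - 2 * RCLike.re ⟪x n, a⟫_ℂ + ‖a‖ ^ 2) atTop
        (𝓝 (‖a‖ ^ 2 - 2 * ‖a‖ ^ 2 + ‖a‖ ^ 2)) :=
      ((hn.pow 2).sub (hre.const_mul 2)).add_const _
    have h4 : ‖a‖ ^ 2 - 2 * ‖a‖ ^ 2 + ‖a‖ ^ 2 = 0 := by ring
    rwa [h4] at h3
  rw [tendsto_iff_norm_sub_tendsto_zero]
  have h := hsq.sqrt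
  simpa [Real.sqrt_sq (norm_nonneg _)] using h

/-- **Near-minimal blow-up sequences have minimal `L³`-limits modulo `Sim`** (registered stub
`stub_nearMinimalLimit` of the line `symmetric-gap`, crux `MinimalDatumPFold`). For `ν > 0` with
`ρ_max^pure(ν) < ⊤`: a sequence of blow-up data `(U k, G k)` — `U k ∈ L³`, `G k ∈ Ḣ^{1/2}`
representing `complexify ∘ U k`, weakly divergence free, without a global Kato solution — with
`‖G k‖ₑ < ρ_max^pure(ν) + (k+1)⁻¹` admits scales `lam j > 0`, centres `x₀ j`, a subsequence `φ` and
a MINIMAL blow-up datum `(u, g)` (`IsMinimalBlowupDatum ν u g`) with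
`x ↦ lam j • U (φ j) (lam j • x - x₀ j)` converging to `u` in `L³`. Proof sketch: blow-up forces
`ρ ≤ ‖G k‖ₑ` (`hasGlobalKatoSolution_of_lt_rusinSverakRhoMaxPure`); the discharged weak-limit
blow-up leaf `rusin_sverak_weak_limit_blowup_holds` modulates; the modulated classes
(`exists_represents_rescaleData_norm_eq`, same norms) have a weakly convergent subsequence
(`exists_strictMono_tendsto_inner`) whose limit `glim` represents a blow-up datum `u`, so
`ρ ≤ ‖glim‖ₑ` and `‖glim‖ ≤ ρ.toReal` (weak l.s.c., `norm_le_of_tendsto_inner_of_norm_le`):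
`(u, glim) ∈ M`; the norms converge to `ρ.toReal = ‖glim‖`, so Radon–Riesz
(`nearMinimalLimit_tendsto_of_tendsto_inner_of_tendsto_norm`) gives strong `Ḣ^{1/2}` convergence,
and `eLpNorm_three_sub_le_of_represents` (BCD 2011 Thm. 1.38) the `L³` convergence.
[cite: RusinSverak2011, Cor. 4.3 and its proof (arXiv:0911.0500 p. 8)] -/
theorem stub_nearMinimalLimit :
    ∀ ν : ℝ, 0 < ν → Literature.Analysis.FluidPDE.rusinSverakRhoMaxPure ν < ⊤ → ∀ (U : ℕ → EuclideanSpace ℝ (Fin 3) → EuclideanSpace ℝ (Fin 3)) (G : ℕ → Literature.Analysis.FunctionSpaces.HomSobolev (EuclideanSpace ℝ (Fin 3)) (EuclideanSpace ℂ (Fin 3)) (1 / 2 : ℝ)), (∀ k : ℕ, MeasureTheory.MemLp (U k) 3 (MeasureTheory.volume : MeasureTheory.Measure (EuclideanSpace ℝ (Fin 3))) ∧ (G k).Represents (Literature.Analysis.FunctionSpaces.EuclideanSpace.complexify ∘ (U k)) ∧ Literature.Analysis.FluidPDE.IsWeaklyDivFree (U k) ∧ ¬ Literature.Analysis.FluidPDE.HasGlobalKatoSolution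 ν (U k) ∧ ‖G k‖ₑ < Literature.Analysis.FluidPDE.rusinSverakRhoMaxPure ν + ((k : ENNReal) + 1)⁻¹) → ∃ (lam : ℕ → ℝ) (x₀ : ℕ → EuclideanSpace ℝ (Fin 3)) (φ : ℕ → ℕ) (u : EuclideanSpace ℝ (Fin 3) → EuclideanSpace ℝ (Fin 3)) (g : Literature.Analysis.FunctionSpaces.HomSobolev (EuclideanSpace ℝ (Fin 3)) (EuclideanSpace ℂ (Fin 3)) (1 / 2 : ℝ)), (∀ j, 0 < lam j) ∧ StrictMono φ ∧ Literature.Analysis.FluidPDE.IsMinimalBlowupDatum ν u g ∧ Filter.Tendsto (fun j => MeasureTheory.eLpNorm (Literature.Analysis.FluidPDE.rescaleData (lam j) (fun x => U (φ j) (x - x₀ j)) - u) 3 (MeasureTheory.volume : MeasureTheory.Measure (EuclideanSpace ℝ (Fin 3)))) Filter.atTop (nhds 0) := by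
  intro ν hν hfin U G hU
  set ρ := Literature.Analysis.FluidPDE.rusinSverakRhoMaxPure ν with hρ
  have hρtop : ρ ≠ ⊤ := hfin.ne
  -- (1) norm bounds: `ρ ≤ ‖G k‖ₑ` (blow-up) and `‖G k‖ ≤ ρ.toReal + 1/(k+1) ≤ ρ.toReal + 1`
  have hinv : ∀ k : ℕ, ((k : ℝ≥0∞) + 1)⁻¹ = ENNReal.ofReal (1 / ((k : ℝ) + 1)) := fun k => by
    rw [one_div, ENNReal.ofReal_inv_of_pos (by positivity),
      ENNReal.ofReal_add (Nat.cast_nonneg k) zero_le_one, ENNReal.ofReal_natCast,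
      ENNReal.ofReal_one]
  have hnorm_le : ∀ k, ‖G k‖ ≤ ρ.toReal + 1 / ((k : ℝ) + 1) := by
    intro k
    have h1 := (hU k).2.2.2.2
    rw [hinv k, ← ofReal_norm, ← ENNReal.ofReal_toReal hρtop,
      ← ENNReal.ofReal_add ENNReal.toReal_nonneg (by positivity)] at h1
    exact ((ENNReal.ofReal_lt_ofReal_iff (by positivity)).1 h1).le
  have hbound : ∀ k, ‖G k‖ ≤ ρ.toReal + 1 := fun k =>
    (hnorm_le k).trans (by
      have : 1 / ((k : ℝ) + 1) ≤ 1 := by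
        rw [div_le_one (by positivity)]
        linarith [(Nat.cast_nonneg k : (0 : ℝ) ≤ k)]
      linarith)
  have hnorm_ge : ∀ k, ρ.toReal ≤ ‖G k‖ := fun k => by
    have hge : ρ ≤ ‖G k‖ₑ := by
      by_contra h
      push Not at h
      exact (hU k).2.2.2.1
        (Literature.Analysis.FluidPDE.hasGlobalKatoSolution_of_lt_rusinSverakRhoMaxPure (hU k).1
          (hU k).2.1 (hU k).2.2.1 h)
    have := ENNReal.toReal_mono (enorm_ne_top (x := G k)) hge
    rwa [toReal_enorm] at this
  -- (2) modulation by the weak-limit blow-up leaf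
  obtain ⟨lam, x₀, hlam, hlim⟩ :=
    Literature.Analysis.FluidPDE.rusin_sverak_weak_limit_blowup_holds ν hν U G
      (fun k => ⟨(hU k).1, (hU k).2.1, (hU k).2.2.1, (hU k).2.2.2.1⟩) ⟨ρ.toReal + 1, hbound⟩
  -- (3) classes of the modulated data, of the same norms
  choose g' hg'rep hg'norm using fun k =>
    Literature.Analysis.FluidPDE.exists_represents_rescaleData_norm_eq (U k) (G k) (hlam k) (x₀ k)
      (hU k).2.1
  -- (4) a weakly convergent subsequence
  haveI : SecondCountableTopology (Literature.Analysis.FunctionSpaces.HomSobolev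
      (EuclideanSpace ℝ (Fin 3)) (EuclideanSpace ℂ (Fin 3)) (1 / 2 : ℝ)) :=
    Literature.Analysis.FluidPDE.homSobolev_half_secondCountableTopology
  obtain ⟨glim, φ, hφ, -, hweak⟩ :=
    Literature.Analysis.FluidPDE.exists_strictMono_tendsto_inner g' (R := ρ.toReal + 1)
      fun n => by rw [hg'norm]; exact hbound n
  -- (5) the weak limit represents a minimal blow-up datum
  obtain ⟨v₀, hv3, hvrep, hvdiv, hvblow⟩ := hlim g' hg'rep φ hφ glim hweak
  have hge : ρ ≤ ‖glim‖ₑ := by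
    by_contra h
    push Not at h
    exact hvblow
      (Literature.Analysis.FluidPDE.hasGlobalKatoSolution_of_lt_rusinSverakRhoMaxPure hv3 hvrep
        hvdiv h)
  have h0 : Tendsto (fun n : ℕ => ρ.toReal + 1 / (((φ n : ℕ) : ℝ) + 1)) atTop (𝓝 ρ.toReal) := by
    have h00 : Tendsto (fun n : ℕ => 1 / ((n : ℝ) + 1)) atTop (𝓝 0) :=
      tendsto_one_div_add_atTop_nhds_zero_nat
    simpa using (h00.comp hφ.tendsto_atTop).const_add ρ.toReal
  have hle : ‖glim‖ ≤ ρ.toReal :=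
    Literature.Analysis.FluidPDE.norm_le_of_tendsto_inner_of_norm_le hweak h0
      (fun n => by rw [hg'norm]; exact hnorm_le (φ n))
  have hnormlim : ‖glim‖ = ρ.toReal := by
    refine le_antisymm hle ?_
    have := ENNReal.toReal_mono (enorm_ne_top (x := glim)) hge
    rwa [toReal_enorm] at this
  have henorm : ‖glim‖ₑ = ρ := by
    rw [← ofReal_norm, hnormlim, ENNReal.ofReal_toReal hρtop]
  have hmin : Literature.Analysis.FluidPDE.IsMinimalBlowupDatum ν v₀ glim :=
    ⟨hv3, hvrep, hvdiv, henorm, hvblow⟩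
  -- (6) the norms converge, hence strong `Ḣ^{1/2}` convergence (Radon–Riesz)
  have hnt : Tendsto (fun n => ‖g' (φ n)‖) atTop (𝓝 ‖glim‖) := by
    rw [hnormlim]
    refine tendsto_of_tendsto_of_tendsto_of_le_of_le tendsto_const_nhds h0 (fun n => ?_)
      (fun n => ?_)
    · rw [hg'norm]; exact hnorm_ge (φ n)
    · rw [hg'norm]; exact hnorm_le (φ n)
  have htend : Tendsto (fun n => g' (φ n)) atTop (𝓝 glim) :=
    nearMinimalLimit_tendsto_of_tendsto_inner_of_tendsto_norm hweak hnt
  -- (7) `L³` convergence of the modulated data along `φ`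
  refine ⟨fun j => lam (φ j), fun j => x₀ (φ j), φ, v₀, glim, fun j => hlam (φ j), hφ, hmin, ?_⟩
  obtain ⟨C, hC⟩ :=
    Literature.Analysis.FluidPDE.exists_const_eLpNorm_three_le_of_represents_complexify
  have hbd : ∀ j, eLpNorm
      (Literature.Analysis.FluidPDE.rescaleData (lam (φ j)) (fun x => U (φ j) (x - x₀ (φ j))) - v₀)
        3 volume ≤ C * ‖g' (φ j) - glim‖ₑ := fun j =>
    PFoldToAxisymmetric.CompactModuloSim.eLpNorm_three_sub_le_of_represents hC (hg'rep (φ j))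
      hvrep
  have hclass : Tendsto (fun j => ‖g' (φ j) - glim‖ₑ) atTop (𝓝 0) := by
    have h := (htend.sub_const glim).enorm
    simpa only [sub_self, enorm_zero] using h
  have hmul : Tendsto (fun j => (C : ℝ≥0∞) * ‖g' (φ j) - glim‖ₑ) atTop (𝓝 0) := by
    simpa only [mul_zero] using ENNReal.Tendsto.const_mul hclass (Or.inr ENNReal.coe_ne_top)
  exact tendsto_of_tendsto_of_tendsto_of_le_of_le tendsto_const_nhds hmul (fun _ => bot_le) hbd

end Summit.NavierStokesRegularity.NavierStokesRegularity.Theorems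

end
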